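import Literature.NumberTheory.Sieve.SmoothParityMajorLattice
import HarnessLib

/-!
# Parity-class friable ternary counts: preparation of the major-arc summation

Topic `Literature/NumberTheory/Sieve`, namespace `Literature.NumberTheory.Sieve.SmoothArcs`; a PROVED tool file of
the circle-method engine of `SmoothParityTernary` ([Harper2016, §5]), sequel of `SmoothParityMajorLattice`.
The major arcs of level `R` and radius `ρ` on the `N₀` sample points are the sets
`{r < N₀ : ‖r/N₀ − a/k‖ ≤ ρ}`, `1 ≤ k ≤ R`, `a < k`, `(k, a) = 1` (`‖·‖ = distInt`, so that the arc at `0/1` is the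
full neighbourhood of `0 ≡ 1`).  This file contains the set-theoretic and abstract-analytic steps of the major-arc
summation:

* `card_filter_distInt_le` (`#{r : ‖r/N₀ − c‖ ≤ ρ} ≤ 4(ρN₀ + 1)`) and the RESONANT off-arc lattice sum
  `sum_filter_inv_mul_inv_distInt_mul_le`: for a dilation `d` prime to `N₀`,
  `Σ_{‖u_r‖ > ρ} 1/((1 + A‖u_r‖)(1 + B‖du_r‖)) ≤ 16N₀/(A·dB·ρ) + (2d/A)·4(1 + (N₀/B)(1 + log N₀))`
  (the model sum of a dilated variable resonates at `β ∈ (1/d_i)ℤ`, where only the free factor decays);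
* `inv_mul_le_distInt_sub` (distinct reduced fractions `a/k ≠ a'/k'` are `1/(kk')`-separated on the circle) and
  `sum_filter_major_eq_sum_arcs`: for `2ρR² < 1` the major arcs are DISJOINT and a sum over the major points is the
  triple sum `Σ_{k ≤ R} Σ_{a} Σ_{r ∈ arc(k,a)}`;
* `norm_arc_sum_sub_le` (ONE ARC, ABSTRACT): a pointwise estimate `‖G(a/k + β) − L·K(β)‖ ≤ D/((1+A|β|)(1+B|β|)) + Fl`
  (`|β| ≤ ρ`, `G, K` of period `1`) sums over the arc to `D·4(1 + (N₀/A)(3 + |log(B/N₀)|)) + 4(ρN₀+1)Fl`;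
* `norm_arc_sum_sub_total_le` (ONE ARC, ABSTRACT): if `‖K(u)‖ ≤ P/((1+A‖u‖)(1+B‖du‖))` and `Σ_{r<N₀} K(r/N₀ − a/k) = T`
  then the arc sum of `K` is `T + O(P·(16N₀/(A dB ρ) + (2d/A)·4(1 + (N₀/B)(1+log N₀))))`;
* `prod_three_flat_le`: the algebra of the flat errors.
## References

* A. J. Harper, Compositio Math. 152 (2016), §5 [Harper2016].
-/

noncomputable section

open Finset Real Complex

namespace Literature.NumberTheory.Sieve

namespace SmoothArcs

open Endgame Vinogradov
open scoped Classical

/-! ### Counting the points of an arc; the resonant off-arc sum -/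

/-- **Number of sample points on an arc**: `#{r < N₀ : ‖r/N₀ − c‖ ≤ ρ} ≤ 4(ρN₀ + 1)` (`ρ ≥ 0`). [folklore] -/
theorem card_filter_distInt_le {N₀ : ℕ} (hN : 0 < N₀) {ρ : ℝ} (hρ : 0 ≤ ρ) (c : ℝ) :
    (((Finset.range N₀).filter (fun r : ℕ => distInt ((r : ℝ) / N₀ - c) ≤ ρ)).card : ℝ) ≤ 4 * (ρ * N₀ + 1) := by
  classical
  have hN0 : (0 : ℝ) < N₀ := by exact_mod_cast hN
  set φ : ℝ → ℝ := fun v => if v ≤ ρ * N₀ then 1 else 0 with hφ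
  have hφ0 : ∀ v, 0 ≤ v → 0 ≤ φ v := fun v _ => by simp only [hφ]; split_ifs <;> norm_num
  have hφm : ∀ v w, 0 ≤ v → v ≤ w → φ w ≤ φ v := by
    intro v w _ hvw
    simp only [hφ]
    split_ifs with h1 h2
    · norm_num
    · exact absurd (hvw.trans h1) h2
    · norm_num
    · norm_num
  have h := sum_range_antitone_distInt_le hN c hφ0 hφm
  have hL : (((Finset.range N₀).filter (fun r : ℕ => distInt ((r : ℝ) / N₀ - c) ≤ ρ)).card : ℝ) =
      ∑ r ∈ Finset.range N₀, φ (N₀ * distInt ((r : ℝ) / N₀ - c)) := by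
    rw [Finset.card_eq_sum_ones, Nat.cast_sum, Finset.sum_filter]
    refine Finset.sum_congr rfl fun r _ => ?_
    have hiff : (N₀ : ℝ) * distInt ((r : ℝ) / N₀ - c) ≤ ρ * N₀ ↔ distInt ((r : ℝ) / N₀ - c) ≤ ρ := by
      rw [mul_comm]; exact mul_le_mul_iff_left₀ hN0
    simp only [hφ, hiff]
    split_ifs <;> simp
  have hR : ∑ j ∈ Finset.range N₀, φ j ≤ ρ * N₀ + 1 := by
    have hle : ∀ j ∈ Finset.range N₀, φ j ≤ (if j ≤ ⌊ρ * N₀⌋₊ then (1 : ℝ) else 0) := by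
      intro j _
      simp only [hφ]
      by_cases hj : (j : ℝ) ≤ ρ * N₀
      · rw [if_pos hj, if_pos (Nat.le_floor hj)]
      · rw [if_neg hj]; split_ifs <;> norm_num
    refine (Finset.sum_le_sum hle).trans ?_
    rw [← Finset.sum_filter, Finset.sum_const, nsmul_eq_mul, mul_one]
    have hc : ((Finset.range N₀).filter (fun j => j ≤ ⌊ρ * N₀⌋₊)).card ≤ ⌊ρ * N₀⌋₊ + 1 :=
      (Finset.card_le_card (fun j hj => Finset.mem_range.mpr (Nat.lt_succ_of_le (Finset.mem_filter.mp hj).2))).trans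
        (Finset.card_range _).le
    calc ((((Finset.range N₀).filter (fun j => j ≤ ⌊ρ * N₀⌋₊)).card : ℕ) : ℝ) ≤ ((⌊ρ * N₀⌋₊ + 1 : ℕ) : ℝ) := by
          exact_mod_cast hc
      _ ≤ ρ * N₀ + 1 := by push_cast; linarith [Nat.floor_le (by positivity : 0 ≤ ρ * N₀)]
  rw [hL]
  exact h.trans (by linarith)

/-- **The resonant off-arc sum.** For `N₀ ≥ 1`, a dilation `d ≥ 1` prime to `N₀`, `A, B > 0`, a radius `ρ > 0` with
`ρN₀ ≥ 1` and any centre `c`: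
`Σ_{r<N₀, ‖u_r‖>ρ} 1/((1 + A‖u_r‖)(1 + B‖d u_r‖)) ≤ 16N₀/(A (dB) ρ) + (2d/A) · 4(1 + (N₀/B)(1 + log N₀))`
(`u_r = r/N₀ − c`): where `‖u_r‖ ≤ 1/(2d)` one has `‖du_r‖ = d‖u_r‖` (`sum_filter_inv_mul_inv_distInt_le` with `dB`);
where `‖u_r‖ > 1/(2d)` the first factor is `≤ 2d/A` and `r ↦ dr` permutes the sample points
(`sum_range_comp_mul_eq_of_coprime`, `sum_range_inv_one_add_distInt_le`). [folklore] -/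
theorem sum_filter_inv_mul_inv_distInt_mul_le {N₀ d : ℕ} (hN : 0 < N₀) (hd : 1 ≤ d) (hcop : Nat.Coprime d N₀)
    {A B ρ : ℝ} (hA : 0 < A) (hB : 0 < B) (hρ : 0 < ρ) (hρN : 1 ≤ ρ * N₀) (c : ℝ) :
    ∑ r ∈ (Finset.range N₀).filter (fun r : ℕ => ρ < distInt ((r : ℝ) / N₀ - c)),
        1 / ((1 + A * distInt ((r : ℝ) / N₀ - c)) * (1 + B * distInt ((d : ℝ) * ((r : ℝ) / N₀ - c)))) ≤
      16 * N₀ / (A * ((d : ℝ) * B) * ρ) + 2 * d / A * (4 * (1 + (N₀ : ℝ) / B * (1 + Real.log N₀))) := by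
  classical
  have hN0 : (0 : ℝ) < N₀ := by exact_mod_cast hN
  have hd0 : (0 : ℝ) < d := by exact_mod_cast hd
  set S := (Finset.range N₀).filter (fun r : ℕ => ρ < distInt ((r : ℝ) / N₀ - c)) with hS
  set f : ℕ → ℝ := fun r => 1 / ((1 + A * distInt ((r : ℝ) / N₀ - c)) * (1 + B * distInt ((d : ℝ) * ((r : ℝ) / N₀ - c))))
    with hf
  have hf0 : ∀ r, 0 ≤ f r := fun r => by
    simp only [hf]; have := distInt_nonneg ((r : ℝ) / N₀ - c); have := distInt_nonneg ((d : ℝ) * ((r : ℝ) / N₀ - c))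
    positivity
  -- region I: `‖u‖ ≤ 1/(2d)`
  have hI : ∑ r ∈ S.filter (fun r : ℕ => distInt ((r : ℝ) / N₀ - c) ≤ 1 / (2 * d)), f r ≤ 16 * N₀ / (A * ((d : ℝ) * B) * ρ) := by
    have h1 : ∀ r ∈ S.filter (fun r : ℕ => distInt ((r : ℝ) / N₀ - c) ≤ 1 / (2 * d)),
        f r = 1 / ((1 + A * distInt ((r : ℝ) / N₀ - c)) * (1 + ((d : ℝ) * B) * distInt ((r : ℝ) / N₀ - c))) := by
      intro r hr
      have hr' := (Finset.mem_filter.mp hr).2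
      have hmul : (d : ℝ) * distInt ((r : ℝ) / N₀ - c) ≤ 1 / 2 := by
        rw [le_div_iff₀ (by positivity)] at hr'
        linarith
      simp only [hf]
      rw [distInt_natCast_mul hmul]
      ring_nf
    rw [Finset.sum_congr rfl h1]
    calc ∑ r ∈ S.filter (fun r : ℕ => distInt ((r : ℝ) / N₀ - c) ≤ 1 / (2 * d)),
          1 / ((1 + A * distInt ((r : ℝ) / N₀ - c)) * (1 + ((d : ℝ) * B) * distInt ((r : ℝ) / N₀ - c)))
        ≤ ∑ r ∈ S, 1 / ((1 + A * distInt ((r : ℝ) / N₀ - c)) * (1 + ((d : ℝ) * B) * distInt ((r : ℝ) / N₀ - c))) :=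
          Finset.sum_le_sum_of_subset_of_nonneg (Finset.filter_subset _ _) fun r _ _ => by
            have := distInt_nonneg ((r : ℝ) / N₀ - c); positivity
      _ ≤ _ := sum_filter_inv_mul_inv_distInt_le hN hA (by positivity) hρ hρN c
  -- region II: `‖u‖ > 1/(2d)`
  have hII : ∑ r ∈ S.filter (fun r : ℕ => ¬ distInt ((r : ℝ) / N₀ - c) ≤ 1 / (2 * d)), f r ≤
      2 * d / A * (4 * (1 + (N₀ : ℝ) / B * (1 + Real.log N₀))) := by
    have h1 : ∀ r ∈ S.filter (fun r : ℕ => ¬ distInt ((r : ℝ) / N₀ - c) ≤ 1 / (2 * d)),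
        f r ≤ 2 * d / A * (1 / (1 + B * distInt ((d : ℝ) * ((r : ℝ) / N₀ - c)))) := by
      intro r hr
      have hr' := not_le.mp (Finset.mem_filter.mp hr).2
      have hδ := distInt_nonneg ((d : ℝ) * ((r : ℝ) / N₀ - c))
      simp only [hf]
      rw [mul_comm (1 + A * _) (1 + B * _), ← one_div_mul_one_div, mul_comm]
      refine mul_le_mul_of_nonneg_right ?_ (by positivity)
      rw [div_eq_mul_one_div (2 * (d : ℝ)) A, show (2 * d : ℝ) * (1 / A) = 1 / (A / (2 * d)) by field_simp]
      apply one_div_le_one_div_of_le (by positivity)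
      have : A / (2 * d) = A * (1 / (2 * d)) := by ring
      rw [this]
      nlinarith [mul_le_mul_of_nonneg_left hr'.le hA.le]
    refine (Finset.sum_le_sum h1).trans ?_
    rw [← Finset.mul_sum]
    refine mul_le_mul_of_nonneg_left ?_ (by positivity)
    calc ∑ r ∈ S.filter (fun r : ℕ => ¬ distInt ((r : ℝ) / N₀ - c) ≤ 1 / (2 * d)),
          1 / (1 + B * distInt ((d : ℝ) * ((r : ℝ) / N₀ - c)))
        ≤ ∑ r ∈ Finset.range N₀, 1 / (1 + B * distInt ((d : ℝ) * ((r : ℝ) / N₀ - c))) :=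
          Finset.sum_le_sum_of_subset_of_nonneg ((Finset.filter_subset _ _).trans (Finset.filter_subset _ _))
            fun r _ _ => by have := distInt_nonneg ((d : ℝ) * ((r : ℝ) / N₀ - c)); positivity
      _ = ∑ r ∈ Finset.range N₀, 1 / (1 + B * distInt (((d * r : ℕ) : ℝ) / N₀ + -((d : ℝ) * c))) := by
          refine Finset.sum_congr rfl fun r _ => ?_
          congr 3; push_cast; ring
      _ = ∑ r ∈ Finset.range N₀, 1 / (1 + B * distInt ((r : ℝ) / N₀ + -((d : ℝ) * c))) :=
          sum_range_comp_mul_eq_of_coprime hN hcop (ψ := fun v => 1 / (1 + B * distInt v))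
            (fun v n => by simp only [distInt_add_int]) _
      _ ≤ 4 * (1 + (N₀ : ℝ) / B * (1 + Real.log N₀)) := by
          have := sum_range_inv_one_add_distInt_le hN hB ((d : ℝ) * c)
          simpa only [sub_eq_add_neg] using this
  rw [← Finset.sum_filter_add_sum_filter_not S (fun r : ℕ => distInt ((r : ℝ) / N₀ - c) ≤ 1 / (2 * d)) f]
  exact add_le_add hI hII


/-! ### Distinct reduced fractions are separated; the major arcs are disjoint -/

/-- **Distinct reduced fractions with denominators `k, k'` are `1/(kk')`-separated on the circle**:
for `a < k`, `a' < k'` with `(k,a) = (k',a') = 1` and `(k, a) ≠ (k', a')`, `‖a/k − a'/k'‖ ≥ 1/(kk')`. [folklore] -/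
theorem inv_mul_le_distInt_sub {k k' a a' : ℕ} (hk : 0 < k) (hk' : 0 < k') (ha : a < k) (ha' : a' < k')
    (hc : Nat.Coprime k a) (hc' : Nat.Coprime k' a') (hne : (k, a) ≠ (k', a')) :
    1 / ((k : ℝ) * k') ≤ distInt ((a : ℝ) / k - (a' : ℝ) / k') := by
  have hk0 : (0 : ℝ) < k := by exact_mod_cast hk
  have hq : (0 : ℝ) < (k : ℝ) * k' := mul_pos hk0 (by exact_mod_cast hk')
  set m : ℤ := (a : ℤ) * k' - (a' : ℤ) * k with hm
  set n : ℤ := round (((a : ℝ) / k - (a' : ℝ) / k')) with hn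
  have hfrac : (a : ℝ) / k - (a' : ℝ) / k' = (m : ℝ) / ((k : ℝ) * k') := by
    rw [hm]; push_cast; field_simp
  have hdist : distInt ((a : ℝ) / k - (a' : ℝ) / k') = |((m - n * (k * k') : ℤ) : ℝ)| / ((k : ℝ) * k') := by
    unfold distInt
    rw [← hn, hfrac]
    push_cast
    rw [show (m : ℝ) / ((k : ℝ) * k') - (n : ℝ) = ((m : ℝ) - n * (k * k')) / ((k : ℝ) * k') by field_simp, abs_div,
      abs_of_pos hq]
  rw [hdist]
  refine div_le_div_of_nonneg_right ?_ hq.le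
  -- the integer `m − n kk'` is nonzero
  have hne0 : m - n * (k * k') ≠ 0 := by
    intro h0
    have hmq : m = n * (k * k') := by linarith
    -- `|m| < kk'` forces `n = 0`
    have hmlt : |m| < (k : ℤ) * k' := by
      rw [hm, abs_lt]
      have h1 : (a : ℤ) * k' < k * k' := by exact_mod_cast Nat.mul_lt_mul_of_pos_right ha hk'
      have h2 : (a' : ℤ) * k < k * k' := by
        have := Nat.mul_lt_mul_of_pos_right ha' hk; rw [mul_comm k' k] at this; exact_mod_cast this
      have h3 : (0 : ℤ) ≤ (a : ℤ) * k' := by positivity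
      have h4 : (0 : ℤ) ≤ (a' : ℤ) * k := by positivity
      constructor <;> linarith
    have hn0 : n = 0 := by
      by_contra hn0
      have h1 : (1 : ℤ) ≤ |n| := Int.one_le_abs hn0
      have hkk : (0 : ℤ) < k * k' := by exact_mod_cast Nat.mul_pos hk hk'
      have : (k : ℤ) * k' ≤ |m| := by
        rw [hmq, abs_mul, abs_of_pos hkk]
        nlinarith
      linarith
    rw [hn0, zero_mul] at hmq
    -- `a k' = a' k` with the coprimality gives `(k, a) = (k', a')`
    have heq : a * k' = a' * k := by
      have : (a : ℤ) * k' = a' * k := by linarith [hmq]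
      exact_mod_cast this
    have hkk' : k ∣ k' := hc.dvd_of_dvd_mul_left ⟨a', by rw [heq, mul_comm]⟩
    have hk'k : k' ∣ k := hc'.dvd_of_dvd_mul_left ⟨a, by rw [← heq, mul_comm]⟩
    have hkeq : k = k' := Nat.dvd_antisymm hkk' hk'k
    subst hkeq
    have haeq : a = a' := Nat.eq_of_mul_eq_mul_right hk heq
    exact hne (by rw [haeq])
  have h1 : (1 : ℤ) ≤ |m - n * (k * k')| := Int.one_le_abs hne0
  rw [← Int.cast_abs]
  exact_mod_cast h1

/-- **The major arcs as a disjoint union.** For `2ρR² < 1` and any `F`: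
`Σ_{r < N₀ : ∃ k ≤ R, ∃ a < k, (k,a)=1, ‖r/N₀ − a/k‖ ≤ ρ} F(r) = Σ_{k ≤ R} Σ_{a < k, (k,a)=1} Σ_{r<N₀, ‖r/N₀ − a/k‖ ≤ ρ} F(r)`
(two arcs meeting at `r` would give `‖a/k − a'/k'‖ ≤ 2ρ < 1/R² ≤ 1/(kk')`). [cite: Harper2016, §5] -/
theorem sum_filter_major_eq_sum_arcs {N₀ R : ℕ} {ρ : ℝ} (hR : 2 * ρ * (R : ℝ) ^ 2 < 1) (F : ℕ → ℂ) :
    ∑ r ∈ (Finset.range N₀).filter (fun r : ℕ => ∃ k : ℕ, 1 ≤ k ∧ k ≤ R ∧ ∃ a : ℕ, a < k ∧ Nat.Coprime k a ∧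
        distInt ((r : ℝ) / N₀ - (a : ℝ) / k) ≤ ρ), F r =
      ∑ k ∈ Icc 1 R, ∑ a ∈ (Finset.range k).filter (Nat.Coprime k),
        ∑ r ∈ (Finset.range N₀).filter (fun r : ℕ => distInt ((r : ℝ) / N₀ - (a : ℝ) / k) ≤ ρ), F r := by
  classical
  set P : Finset (Σ _ : ℕ, ℕ) := (Icc 1 R).sigma (fun k => (Finset.range k).filter (Nat.Coprime k)) with hP
  set arc : (Σ _ : ℕ, ℕ) → Finset ℕ := fun p =>
    (Finset.range N₀).filter (fun r : ℕ => distInt ((r : ℝ) / N₀ - (p.2 : ℝ) / p.1) ≤ ρ) with harc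
  have hset : (Finset.range N₀).filter (fun r : ℕ => ∃ k : ℕ, 1 ≤ k ∧ k ≤ R ∧ ∃ a : ℕ, a < k ∧ Nat.Coprime k a ∧
      distInt ((r : ℝ) / N₀ - (a : ℝ) / k) ≤ ρ) = P.biUnion arc := by
    ext r
    simp only [Finset.mem_filter, Finset.mem_biUnion, hP, Finset.mem_sigma, Finset.mem_Icc, Finset.mem_range, harc]
    constructor
    · rintro ⟨hr, k, hk1, hkR, a, hak, hcop, hd⟩
      exact ⟨⟨k, a⟩, ⟨⟨hk1, hkR⟩, hak, hcop⟩, hr, hd⟩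
    · rintro ⟨⟨k, a⟩, ⟨⟨hk1, hkR⟩, hak, hcop⟩, hr, hd⟩
      exact ⟨hr, k, hk1, hkR, a, hak, hcop, hd⟩
  have hdisj : (P : Set (Σ _ : ℕ, ℕ)).PairwiseDisjoint arc := by
    rintro ⟨k, a⟩ hp ⟨k', a'⟩ hp' hne
    rw [Function.onFun, Finset.disjoint_left]
    intro r hr hr'
    simp only [hP, Finset.coe_sigma, Set.mem_sigma_iff, Finset.mem_coe, Finset.mem_Icc, Finset.mem_filter,
      Finset.mem_range] at hp hp'
    obtain ⟨⟨hk1, hkR⟩, hak, hcop⟩ := hp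
    obtain ⟨⟨hk1', hkR'⟩, hak', hcop'⟩ := hp'
    simp only [harc, Finset.mem_filter] at hr hr'
    have hne' : (k, a) ≠ (k', a') := by
      intro h
      apply hne
      simp only [Prod.mk.injEq] at h
      obtain ⟨rfl, rfl⟩ := h
      rfl
    have hsep := inv_mul_le_distInt_sub hk1 hk1' hak hak' hcop hcop' hne'
    have htri : distInt ((a : ℝ) / k - (a' : ℝ) / k') ≤ 2 * ρ := by
      have e : (a : ℝ) / k - (a' : ℝ) / k' = ((r : ℝ) / N₀ - (a' : ℝ) / k') - ((r : ℝ) / N₀ - (a : ℝ) / k) := by ring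
      rw [e]
      linarith [distInt_sub_le ((r : ℝ) / N₀ - (a' : ℝ) / k') ((r : ℝ) / N₀ - (a : ℝ) / k), hr.2, hr'.2]
    have hkk : (k : ℝ) * k' ≤ (R : ℝ) ^ 2 := by
      have h1 : (k : ℝ) ≤ R := by exact_mod_cast hkR
      nlinarith [(by exact_mod_cast hkR' : (k' : ℝ) ≤ R), Nat.cast_nonneg (α := ℝ) k]
    have hkpos : (0 : ℝ) < (k : ℝ) * k' := mul_pos (by exact_mod_cast hk1) (by exact_mod_cast hk1')
    have h4 : 1 / (R : ℝ) ^ 2 ≤ 1 / ((k : ℝ) * k') := one_div_le_one_div_of_le hkpos hkk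
    have hR2 : (0 : ℝ) < (R : ℝ) ^ 2 := lt_of_lt_of_le hkpos hkk
    have h5 : 2 * ρ < 1 / (R : ℝ) ^ 2 := by rw [lt_div_iff₀ hR2]; exact hR
    linarith
  rw [hset, Finset.sum_biUnion hdisj, hP, Finset.sum_sigma]

/-! ### One arc: the pointwise estimate summed, and the model sum against its complete sum -/

/-- **Summing a pointwise major-arc estimate over one arc.**  Let `G, K : ℝ → ℂ` have period `1`, and suppose
that `‖G(a/k + β) − L·K(β)‖ ≤ D/((1 + A|β|)(1 + B|β|)) + Fl` for `|β| ≤ ρ` (`0 < B ≤ A`, `D, Fl ≥ 0`).  Then on the arc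
`{r < N₀ : ‖r/N₀ − a/k‖ ≤ ρ}`:
`‖Σ_r G(r/N₀) − L Σ_r K(r/N₀ − a/k)‖ ≤ D · 4(1 + (N₀/A)(3 + |log(B/N₀)|)) + 4(ρN₀ + 1) · Fl`
(write `r/N₀ − a/k = n_r + β_r` with `|β_r| = ‖r/N₀ − a/k‖`; `sum_range_inv_mul_inv_distInt_le`,
`card_filter_distInt_le`). [cite: Harper2016, §5] -/
theorem norm_arc_sum_sub_le {N₀ : ℕ} (hN : 0 < N₀) (k a : ℕ) {ρ A B D Fl : ℝ} (hρ : 0 ≤ ρ) (hB : 0 < B)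
    (hBA : B ≤ A) (hD : 0 ≤ D) (hFl : 0 ≤ Fl) {G K : ℝ → ℂ} {L : ℂ} (hG : ∀ (θ : ℝ) (n : ℤ), G (θ + n) = G θ)
    (hK : ∀ (u : ℝ) (n : ℤ), K (u + n) = K u)
    (hpt : ∀ β : ℝ, |β| ≤ ρ → ‖G ((a : ℝ) / k + β) - L * K β‖ ≤ D * (1 / ((1 + A * |β|) * (1 + B * |β|))) + Fl) :
    ‖(∑ r ∈ (Finset.range N₀).filter (fun r : ℕ => distInt ((r : ℝ) / N₀ - (a : ℝ) / k) ≤ ρ), G ((r : ℝ) / N₀)) -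
        L * ∑ r ∈ (Finset.range N₀).filter (fun r : ℕ => distInt ((r : ℝ) / N₀ - (a : ℝ) / k) ≤ ρ),
          K ((r : ℝ) / N₀ - (a : ℝ) / k)‖ ≤
      D * (4 * (1 + (N₀ : ℝ) / A * (3 + |Real.log (B / N₀)|))) + 4 * (ρ * N₀ + 1) * Fl := by
  set arc := (Finset.range N₀).filter (fun r : ℕ => distInt ((r : ℝ) / N₀ - (a : ℝ) / k) ≤ ρ) with harc
  rw [Finset.mul_sum, ← Finset.sum_sub_distrib]
  have hterm : ∀ r ∈ arc, ‖G ((r : ℝ) / N₀) - L * K ((r : ℝ) / N₀ - (a : ℝ) / k)‖ ≤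
      D * (1 / ((1 + A * distInt ((r : ℝ) / N₀ - (a : ℝ) / k)) * (1 + B * distInt ((r : ℝ) / N₀ - (a : ℝ) / k)))) + Fl := by
    intro r hr
    have hr' := (Finset.mem_filter.mp hr).2
    set u : ℝ := (r : ℝ) / N₀ - (a : ℝ) / k with hu
    set β : ℝ := u - round u with hβ
    have hβu : |β| = distInt u := rfl
    have e1 : G ((r : ℝ) / N₀) = G ((a : ℝ) / k + β) := by
      have : (r : ℝ) / N₀ = (a : ℝ) / k + β + ((round u : ℤ) : ℝ) := by rw [hβ, hu]; ring
      rw [this, hG]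
    have e2 : K u = K β := by
      have : u = β + ((round u : ℤ) : ℝ) := by rw [hβ]; ring
      rw [this, hK]
    rw [e1, e2, ← hβu]
    exact hpt β (by rw [hβu]; exact hr')
  refine (norm_sum_le _ _).trans ((Finset.sum_le_sum hterm).trans ?_)
  rw [Finset.sum_add_distrib, Finset.sum_const, nsmul_eq_mul, ← Finset.mul_sum]
  refine add_le_add (mul_le_mul_of_nonneg_left ?_ hD) ?_
  · calc ∑ r ∈ arc, 1 / ((1 + A * distInt ((r : ℝ) / N₀ - (a : ℝ) / k)) * (1 + B * distInt ((r : ℝ) / N₀ - (a : ℝ) / k)))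
        ≤ ∑ r ∈ Finset.range N₀,
            1 / ((1 + A * distInt ((r : ℝ) / N₀ - (a : ℝ) / k)) * (1 + B * distInt ((r : ℝ) / N₀ - (a : ℝ) / k))) :=
          Finset.sum_le_sum_of_subset_of_nonneg (Finset.filter_subset _ _) fun r _ _ => by
            have := distInt_nonneg ((r : ℝ) / N₀ - (a : ℝ) / k)
            have : 0 < A := lt_of_lt_of_le hB hBA
            positivity
      _ ≤ _ := sum_range_inv_mul_inv_distInt_le hN hB hBA _
  · exact mul_le_mul_of_nonneg_right (card_filter_distInt_le hN hρ _) hFl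

/-- **The model sum over one arc against its complete sum.**  Let `K : ℝ → ℂ` satisfy
`‖K(u)‖ ≤ P/((1 + A‖u‖)(1 + B‖du‖))` (`P ≥ 0`, `A, B > 0`, `d ≥ 1` prime to `N₀`) and `Σ_{r<N₀} K(r/N₀ − a/k) = T`.
Then for `ρ > 0` with `ρN₀ ≥ 1`, on the arc `{r < N₀ : ‖r/N₀ − a/k‖ ≤ ρ}`:
`‖Σ_r K(r/N₀ − a/k) − T‖ ≤ P · (16N₀/(A·dB·ρ) + (2d/A)·4(1 + (N₀/B)(1 + log N₀)))`
(`sum_filter_inv_mul_inv_distInt_mul_le` on the complement). [cite: Harper2016, §5] -/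
theorem norm_arc_sum_sub_total_le {N₀ d : ℕ} (hN : 0 < N₀) (hd : 1 ≤ d) (hcop : Nat.Coprime d N₀) (k a : ℕ)
    {ρ A B P : ℝ} (hρ : 0 < ρ) (hρN : 1 ≤ ρ * N₀) (hA : 0 < A) (hB : 0 < B) (hP : 0 ≤ P) {K : ℝ → ℂ} {T : ℂ}
    (hKb : ∀ u : ℝ, ‖K u‖ ≤ P / ((1 + A * distInt u) * (1 + B * distInt ((d : ℝ) * u))))
    (htot : ∑ r ∈ Finset.range N₀, K ((r : ℝ) / N₀ - (a : ℝ) / k) = T) :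
    ‖(∑ r ∈ (Finset.range N₀).filter (fun r : ℕ => distInt ((r : ℝ) / N₀ - (a : ℝ) / k) ≤ ρ),
        K ((r : ℝ) / N₀ - (a : ℝ) / k)) - T‖ ≤
      P * (16 * N₀ / (A * ((d : ℝ) * B) * ρ) + 2 * d / A * (4 * (1 + (N₀ : ℝ) / B * (1 + Real.log N₀)))) := by
  classical
  have hsplit := Finset.sum_filter_add_sum_filter_not (Finset.range N₀)
    (fun r : ℕ => distInt ((r : ℝ) / N₀ - (a : ℝ) / k) ≤ ρ) (fun r => K ((r : ℝ) / N₀ - (a : ℝ) / k))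
  rw [htot] at hsplit
  have e : (∑ r ∈ (Finset.range N₀).filter (fun r : ℕ => distInt ((r : ℝ) / N₀ - (a : ℝ) / k) ≤ ρ),
      K ((r : ℝ) / N₀ - (a : ℝ) / k)) - T =
      -∑ r ∈ (Finset.range N₀).filter (fun r : ℕ => ¬ distInt ((r : ℝ) / N₀ - (a : ℝ) / k) ≤ ρ),
        K ((r : ℝ) / N₀ - (a : ℝ) / k) := by rw [← hsplit]; ring
  rw [e, norm_neg]
  have hfilt : (Finset.range N₀).filter (fun r : ℕ => ¬ distInt ((r : ℝ) / N₀ - (a : ℝ) / k) ≤ ρ) =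
      (Finset.range N₀).filter (fun r : ℕ => ρ < distInt ((r : ℝ) / N₀ - (a : ℝ) / k)) :=
    Finset.filter_congr fun r _ => not_le
  rw [hfilt]
  refine (norm_sum_le _ _).trans ?_
  refine (Finset.sum_le_sum fun r _ => hKb _).trans ?_
  simp_rw [div_eq_mul_one_div P]
  rw [← Finset.mul_sum]
  exact mul_le_mul_of_nonneg_left (sum_filter_inv_mul_inv_distInt_mul_le hN hd hcop hA hB hρ hρN _) hP

/-! ### The flat errors: algebra -/

/-- Monotone expansion for the flat errors: for `0 ≤ H_i`, `0 ≤ b'_i ≤ b_i`, `0 ≤ w_i`,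
`Π(H_ib_i + w_i) − Π H_ib'_i ≤ Π(1 + H_i) · (Π(b_i + w_i) − Πb_i) + H₁H₂H₃ (Πb_i − Πb'_i)`. [folklore] -/
theorem prod_three_flat_le {H₁ H₂ H₃ b₁ b₂ b₃ b₁' b₂' b₃' w₁ w₂ w₃ : ℝ} (hH₁ : 0 ≤ H₁) (hH₂ : 0 ≤ H₂) (hH₃ : 0 ≤ H₃)
    (hb₁ : 0 ≤ b₁') (hb₂ : 0 ≤ b₂') (hb₃ : 0 ≤ b₃') (h₁ : b₁' ≤ b₁) (h₂ : b₂' ≤ b₂) (h₃ : b₃' ≤ b₃)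
    (hw₁ : 0 ≤ w₁) (hw₂ : 0 ≤ w₂) (hw₃ : 0 ≤ w₃) :
    (H₁ * b₁ + w₁) * (H₂ * b₂ + w₂) * (H₃ * b₃ + w₃) - H₁ * b₁' * (H₂ * b₂') * (H₃ * b₃') ≤
      (1 + H₁) * (1 + H₂) * (1 + H₃) * ((b₁ + w₁) * (b₂ + w₂) * (b₃ + w₃) - b₁ * b₂ * b₃) +
        H₁ * H₂ * H₃ * (b₁ * b₂ * b₃ - b₁' * b₂' * b₃') := by
  have hb₁0 : 0 ≤ b₁ := hb₁.trans h₁; have hb₂0 : 0 ≤ b₂ := hb₂.trans h₂; have hb₃0 : 0 ≤ b₃ := hb₃.trans h₃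
  -- `Π(Hb + w) − Π Hb ≤ Π(1+H) (Π(b+w) − Πb)`: compare the seven mixed monomials
  have e1 : (H₁ * b₁ + w₁) * (H₂ * b₂ + w₂) * (H₃ * b₃ + w₃) - H₁ * b₁ * (H₂ * b₂) * (H₃ * b₃) =
      w₁ * (H₂ * b₂) * (H₃ * b₃) + (H₁ * b₁) * w₂ * (H₃ * b₃) + (H₁ * b₁) * (H₂ * b₂) * w₃ +
        w₁ * w₂ * (H₃ * b₃) + w₁ * (H₂ * b₂) * w₃ + (H₁ * b₁) * w₂ * w₃ + w₁ * w₂ * w₃ := by ring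
  have e2 : (b₁ + w₁) * (b₂ + w₂) * (b₃ + w₃) - b₁ * b₂ * b₃ =
      w₁ * b₂ * b₃ + b₁ * w₂ * b₃ + b₁ * b₂ * w₃ + w₁ * w₂ * b₃ + w₁ * b₂ * w₃ + b₁ * w₂ * w₃ + w₁ * w₂ * w₃ := by ring
  set Q : ℝ := (1 + H₁) * (1 + H₂) * (1 + H₃) with hQ
  have hQ1 : H₁ ≤ Q := by rw [hQ]; nlinarith [mul_nonneg hH₁ hH₂, mul_nonneg hH₁ hH₃, mul_nonneg hH₂ hH₃, mul_nonneg (mul_nonneg hH₁ hH₂) hH₃]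
  have hQ2 : H₂ ≤ Q := by rw [hQ]; nlinarith [mul_nonneg hH₁ hH₂, mul_nonneg hH₁ hH₃, mul_nonneg hH₂ hH₃, mul_nonneg (mul_nonneg hH₁ hH₂) hH₃]
  have hQ3 : H₃ ≤ Q := by rw [hQ]; nlinarith [mul_nonneg hH₁ hH₂, mul_nonneg hH₁ hH₃, mul_nonneg hH₂ hH₃, mul_nonneg (mul_nonneg hH₁ hH₂) hH₃]
  have hQ12 : H₁ * H₂ ≤ Q := by rw [hQ]; nlinarith [mul_nonneg hH₁ hH₂, mul_nonneg hH₁ hH₃, mul_nonneg hH₂ hH₃, mul_nonneg (mul_nonneg hH₁ hH₂) hH₃]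
  have hQ13 : H₁ * H₃ ≤ Q := by rw [hQ]; nlinarith [mul_nonneg hH₁ hH₂, mul_nonneg hH₁ hH₃, mul_nonneg hH₂ hH₃, mul_nonneg (mul_nonneg hH₁ hH₂) hH₃]
  have hQ23 : H₂ * H₃ ≤ Q := by rw [hQ]; nlinarith [mul_nonneg hH₁ hH₂, mul_nonneg hH₁ hH₃, mul_nonneg hH₂ hH₃, mul_nonneg (mul_nonneg hH₁ hH₂) hH₃]
  have hQ0 : 1 ≤ Q := by rw [hQ]; nlinarith [mul_nonneg hH₁ hH₂, mul_nonneg hH₁ hH₃, mul_nonneg hH₂ hH₃, mul_nonneg (mul_nonneg hH₁ hH₂) hH₃]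
  have m1 : w₁ * (H₂ * b₂) * (H₃ * b₃) ≤ Q * (w₁ * b₂ * b₃) := by
    have : w₁ * (H₂ * b₂) * (H₃ * b₃) = (H₂ * H₃) * (w₁ * b₂ * b₃) := by ring
    rw [this]; exact mul_le_mul_of_nonneg_right hQ23 (by positivity)
  have m2 : (H₁ * b₁) * w₂ * (H₃ * b₃) ≤ Q * (b₁ * w₂ * b₃) := by
    have : (H₁ * b₁) * w₂ * (H₃ * b₃) = (H₁ * H₃) * (b₁ * w₂ * b₃) := by ring
    rw [this]; exact mul_le_mul_of_nonneg_right hQ13 (by positivity)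
  have m3 : (H₁ * b₁) * (H₂ * b₂) * w₃ ≤ Q * (b₁ * b₂ * w₃) := by
    have : (H₁ * b₁) * (H₂ * b₂) * w₃ = (H₁ * H₂) * (b₁ * b₂ * w₃) := by ring
    rw [this]; exact mul_le_mul_of_nonneg_right hQ12 (by positivity)
  have m4 : w₁ * w₂ * (H₃ * b₃) ≤ Q * (w₁ * w₂ * b₃) := by
    have : w₁ * w₂ * (H₃ * b₃) = H₃ * (w₁ * w₂ * b₃) := by ring
    rw [this]; exact mul_le_mul_of_nonneg_right hQ3 (by positivity)
  have m5 : w₁ * (H₂ * b₂) * w₃ ≤ Q * (w₁ * b₂ * w₃) := by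
    have : w₁ * (H₂ * b₂) * w₃ = H₂ * (w₁ * b₂ * w₃) := by ring
    rw [this]; exact mul_le_mul_of_nonneg_right hQ2 (by positivity)
  have m6 : (H₁ * b₁) * w₂ * w₃ ≤ Q * (b₁ * w₂ * w₃) := by
    have : (H₁ * b₁) * w₂ * w₃ = H₁ * (b₁ * w₂ * w₃) := by ring
    rw [this]; exact mul_le_mul_of_nonneg_right hQ1 (by positivity)
  have m7 : w₁ * w₂ * w₃ ≤ Q * (w₁ * w₂ * w₃) := le_mul_of_one_le_left (by positivity) hQ0
  -- `Π Hb − Π Hb' = H₁H₂H₃ (Πb − Πb')`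
  have e3 : H₁ * b₁ * (H₂ * b₂) * (H₃ * b₃) - H₁ * b₁' * (H₂ * b₂') * (H₃ * b₃') =
      H₁ * H₂ * H₃ * (b₁ * b₂ * b₃ - b₁' * b₂' * b₃') := by ring
  nlinarith [e1, e2, e3, m1, m2, m3, m4, m5, m6, m7]

end SmoothArcs

end Literature.NumberTheory.Sieve

end
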